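import Summits.HodgeConjecture.HodgeConjecture.Theorems.F0P2cSocketC                        -- ★ (C♭) frame currency: `locF`, `imagUnitSq`, `rhoAtLine`, `IsConjugateSymplectic.cmType`
import Summits.HodgeConjecture.HodgeConjecture.Theorems.F0P2sThetaOccursInLineTransport      -- ★ `exists_admissibleUnit_of_hadm` (admissible `e` ↦ unit `a′ = e·2δ`)
import Literature.NumberTheory.Automorphic.Liu2021.Def412AdmissibleIffParity                 -- ★ `isAdmissible_epsOf_iff_even` ([Liu2021, Def. 4.12] ⟺ parity, O'Meara 71:19)
import Literature.NumberTheory.GelbartRogawski1991.Prop311PrintedCML2                        -- ★ `embedding_of_isReal_imagUnitSq_neg` (`δ_L² < 0` at every real place)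
import Summits.HodgeConjecture.HodgeConjecture.Theorems.K2E2AdmLocFNeOneFinite   -- ★ socket closer landed: `admLocFNeOneFinite` (RE-TIE BY IMPORT, ED. 2)
import Summits.HodgeConjecture.HodgeConjecture.Theorems.K2E2AdmExistsAdmissibleOfEven   -- ★ socket closer landed: `admExistsAdmissibleOfEven` (RE-TIE BY IMPORT, ED. 2)
import Summits.HodgeConjecture.HodgeConjecture.Theorems.K2E2AdmUnitOfAdmissibleElement   -- ★ socket closer landed: `admUnitOfAdmissibleElement` (RE-TIE BY IMPORT, ED. 2)
import Summits.HodgeConjecture.HodgeConjecture.Theorems.K2E2AdmRepresentative   -- ★ socket closer landed: `admRepresentative` (RE-TIE BY IMPORT, ED. 2)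
import HarnessLib

/-!
RE-TIE EDITION (2026-09-03T22:20Z): every landed socket of this module is now `:= @<landed decl>` BY IMPORT (statement bytes frozen); see the per-theorem comments.

# K2 ∕ E2 «ThetaExhaustionByRigidity» — tier-1 sockets, unit **ADM-REP** (the admissible representative of a parity-even line)

Track B «K2-LIT», engine E2 (Weil representation ∕ theta ∕ ε-dichotomy), crux H413 (`stmt-HodgeConjecture-24833`), route of record
`route-HodgeConjecture-HCCMUnconditional`.  Tier-0 line: `Cruxes/H413/Lines/K2_E2_ThetaExhaustionByRigidity.lean` (stub `stub_admissibleRepresentative`,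
`def StubAdmissibleRepresentative`).  This module holds the unit's SOCKETS `theorem sig_K2E2Adm… : ‹statement› := by sorry` — one per planned tier-2 file
`Theorems/K2E2Adm….lean`; a prover closes a socket by proving a theorem with the SAME type in `Theorems/` and the lead re-ties the tier-0 stub.
RULES KEPT: no `def`∕`structure`∕`instance`∕`notation` here (R3 (d): every constant below is ★ in the imported leaves); imports are ★ `Theorems`∕`Literature`
only (no `Lines`); statement of the closer `sig_K2E2AdmRepresentative` = the tier-0 `StubAdmissibleRepresentative` VERBATIM.
CHAIN: `sig_K2E2AdmLocFNeOneFinite` + `sig_K2E2AdmExistsAdmissibleOfEven` (★ `isAdmissible_epsOf_iff_even`.mpr) → `sig_K2E2AdmUnitOfAdmissibleElement`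
(★ `exists_admissibleUnit_of_hadm`) → `sig_K2E2AdmRepresentative`.
HONEST LABEL: HC_CM is proved only modulo the 7 printed citations (2 remaining named inputs: hLiu418 = stmt-HodgeConjecture-24832, h413 =
stmt-HodgeConjecture-24833) until rung 0 closes; nothing here changes any count.
-/

set_option Elab.async false
set_option autoImplicit false
set_option linter.dupNamespace false

namespace Summit.HodgeConjecture.HodgeConjecture.Cruxes.H413.K2E2ThetaExhaustionByRigidity.AdmRep

open scoped TensorProduct Matrix ComplexOrder
open NumberField NumberField.InfinitePlace IsDedekindDomain MeasureTheory
open Literature.NumberTheory Literature.NumberTheory.Automorphic Literature.NumberTheory.Automorphic.UnitaryGroup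
open Literature.NumberTheory.Automorphic.Liu2021
open Literature.NumberTheory.Automorphic.Liu2021.Def411WeilCarriers
open Literature.NumberTheory.Automorphic.Liu2021.Def411WeilCarriersDoubling
open Literature.NumberTheory.Automorphic.IdeleClassGroup
open Literature.NumberTheory.GelbartRogawski1991 Literature.NumberTheory.GelbartRogawski1991.UnitaryDualPair
open Literature.NumberTheory.GelbartRogawski1991.UnitaryDualPair.WeilCoinv
open Literature.RepresentationTheory Literature.RepresentationTheory.Liu2021
open Literature.AlgebraicGeometry.Liu2021 (IsAdmissibleElement)
open Summit.HodgeConjecture.CorCM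

/-- **sig ADM-1 (size S) — the local norm classes of a line are trivial at almost every finite place.**  For `a ∈ (L⁺)ˣ` the collection
`locF L⁺ (δ_L²) a : v ↦ [a]_v ∈ L⁺_vˣ ⧸ N(L_vˣ)` (the Hilbert symbol `(a, δ_L²)_v`) is `1` outside the finite set of places dividing `2·a·δ_L²`.
Needed because the E3♭ parity hypothesis is phrased with `Set.ncard` (junk value `0` on an infinite set) while ★ `isAdmissible_epsOf_iff_even` wants
`Set.Finite` explicitly.  PLAN: unramified computation of the local norm class (★ `Def411WeilCarriers` API around `locF`; [Omeara1963, 63:11a ∕ §71]).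
[cite: Omeara1963, §71 Thm. 71:18 (Hilbert reciprocity; almost all symbols trivial)] [cite: Liu2021, Def. 4.11 (l. 2090–2096)]
size: S · deps: ★ `Def411WeilCarriers.locF` · unit: ADM-REP · tier-2 target `Theorems/K2E2AdmLocFNeOneFinite.lean` -/
theorem sig_K2E2AdmLocFNeOneFinite :
    ∀ (L : Type) [Field L] [NumberField L] [IsCMField L] (a : (↥(maximalRealSubfield L))ˣ),
      {v : HeightOneSpectrum (𝓞 ↥(maximalRealSubfield L)) |
          locF (↥(maximalRealSubfield L)) (imagUnitSq L) a v ≠ 1}.Finite :=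
  @Summit.HodgeConjecture.HodgeConjecture.Cruxes.H413.K2E2AdmLocFNeOneFinite.admLocFNeOneFinite  -- ★ RE-TIED BY IMPORT (statement bytes above FROZEN ∕ unchanged)

/-- **sig ADM-2 (size S) — parity-even ⟹ an admissible element with the prescribed collection.**  For conjugate-symplectic `μ` (CM type `Φ_μ = hμ.cmType`)
and a line `a` with EVEN E3♭-count `#{v : [a]_v ≠ 1} + #{φ ∈ Φ_μ : Im φ((2δ_L)⁻¹) > 0}`, there is `e ∈ L` admissible for `Φ_μ` ([Liu2021, Def. 4.12]) whose
collection `epsOf (2δ_L)⁻¹ e` is `locF a`.  PLAN: ★ `isAdmissible_epsOf_iff_even Φ_μ (hδ) (hδ0) (imagUnitSq L) (hd0) (★ embedding_of_isReal_imagUnitSq_neg) (locF a)`.mpr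
applied to `⟨sig_K2E2AdmLocFNeOneFinite, h⟩` (`δ := (2·imagUnit L)⁻¹` is purely imaginary and non-zero: ★ `complexConj_imagUnit`, `imagUnit_ne_zero`).
[cite: Liu2021, Def. 4.12 (l. 2102–2108); Rem. 4.14; App. C l. 4550] [cite: Omeara1963, §71 Thm. 71:19, Cor. 71:19a]
audit: Liu21 FJcycle.tex L2103–2107 «Definition 4.12 … we say that ε is μ-admissible if …» · size: S · deps: ★ `isAdmissible_epsOf_iff_even`, ADM-1 · unit: ADM-REP ·
tier-2 target `Theorems/K2E2AdmExistsAdmissibleOfEven.lean` -/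
theorem sig_K2E2AdmExistsAdmissibleOfEven :
    ∀ (L : Type) [Field L] [NumberField L] [IsCMField L]
      (μ : Literature.NumberTheory.Automorphic.IdeleClassGroup L →ₜ* Circle) (hμ : IsConjugateSymplectic L μ)
      (a : (↥(maximalRealSubfield L))ˣ),
      Even ({v : HeightOneSpectrum (𝓞 ↥(maximalRealSubfield L)) |
              locF (↥(maximalRealSubfield L)) (imagUnitSq L) a v ≠ 1}.ncard +
        {φ : L →+* ℂ | φ ∈ hμ.cmType.1 ∧ 0 < (φ (2 * imagUnit L)⁻¹).im}.ncard) →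
      ∃ e : L, IsAdmissibleElement L hμ.cmType.1 e ∧
        epsOf (↥(maximalRealSubfield L)) (imagUnitSq L) L (2 * imagUnit L)⁻¹ e =
          locF (↥(maximalRealSubfield L)) (imagUnitSq L) a :=
  @Summit.HodgeConjecture.HodgeConjecture.Cruxes.H413.K2E2AdmExistsAdmissibleOfEven.admExistsAdmissibleOfEven  -- ★ RE-TIED BY IMPORT (statement bytes above FROZEN ∕ unchanged)

/-- **sig ADM-3 (size S) — from an admissible element to an admissible UNIT REPRESENTATIVE of the same collection.**  If `e` is `Φ`-admissible with
`epsOf (2δ_L)⁻¹ e = locF a`, then `a′ := e · 2δ_L ∈ (L⁺)ˣ` (★ `exists_admissibleUnit_of_hadm`: real, non-zero, `locF a′ = locF a`) and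
`a′ · (2δ_L)⁻¹ = e` is `Φ`-admissible (rewrite `(a′ : L) = e · (2·imagUnit L)`, `mul_inv_cancel_right₀`).
[cite: Liu2021, Def. 4.12 (l. 2102–2108)] size: S · deps: ★ `F0P2sThetaOccursInLineTransport.exists_admissibleUnit_of_hadm` · unit: ADM-REP ·
tier-2 target `Theorems/K2E2AdmUnitOfAdmissibleElement.lean` -/
theorem sig_K2E2AdmUnitOfAdmissibleElement :
    ∀ (L : Type) [Field L] [NumberField L] [IsCMField L] (Φ : Set (L →+* ℂ)) (a : (↥(maximalRealSubfield L))ˣ),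
      (∃ e : L, IsAdmissibleElement L Φ e ∧
        epsOf (↥(maximalRealSubfield L)) (imagUnitSq L) L (2 * imagUnit L)⁻¹ e = locF (↥(maximalRealSubfield L)) (imagUnitSq L) a) →
      ∃ a' : (↥(maximalRealSubfield L))ˣ,
        locF (↥(maximalRealSubfield L)) (imagUnitSq L) a' = locF (↥(maximalRealSubfield L)) (imagUnitSq L) a ∧
        IsAdmissibleElement L Φ (algebraMap (↥(maximalRealSubfield L)) L a' * (2 * imagUnit L)⁻¹) :=
  @Summit.HodgeConjecture.HodgeConjecture.Cruxes.H413.K2E2AdmUnitOfAdmissibleElement.admUnitOfAdmissibleElement  -- ★ RE-TIED BY IMPORT (statement bytes above FROZEN ∕ unchanged)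

/-- **sig ADM-4 = the tier-0 stub `StubAdmissibleRepresentative` VERBATIM (closer, size S given ADM-2 + ADM-3).**  For conjugate-symplectic `μ` and a line `a`
with even E3♭-count there is `a′ ∈ (L⁺)ˣ` with `locF a′ = locF a` and `a′(2δ_L)⁻¹` `Φ_μ`-admissible.  PLAN: `sig_K2E2AdmExistsAdmissibleOfEven` then
`sig_K2E2AdmUnitOfAdmissibleElement hμ.cmType.1`.  Why it might fail: only a sign-convention slip (`Im < 0` vs `> 0`) between `IsAdmissibleElement` and the
E3♭ count — guarded by ★ `isAdmissible_epsOf_iff_even` using both conventions at once.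
[cite: Liu2021, Def. 4.12 (l. 2102–2108); Rem. 4.14] [cite: Omeara1963, §71 Thm. 71:18, Thm. 71:19] [cite: Rogawski1992, Thm. 1.1]
size: S · deps: ADM-2, ADM-3 · unit: ADM-REP · re-ties tier-0 `stub_admissibleRepresentative` · tier-2 target `Theorems/K2E2AdmRepresentative.lean` -/
theorem sig_K2E2AdmRepresentative :
    ∀ (L : Type) [Field L] [NumberField L] [IsCMField L]
      (μ : Literature.NumberTheory.Automorphic.IdeleClassGroup L →ₜ* Circle) (hμ : IsConjugateSymplectic L μ)
      (a : (↥(maximalRealSubfield L))ˣ),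
      Even ({v : HeightOneSpectrum (𝓞 ↥(maximalRealSubfield L)) |
              locF (↥(maximalRealSubfield L)) (imagUnitSq L) a v ≠ 1}.ncard +
        {φ : L →+* ℂ | φ ∈ hμ.cmType.1 ∧ 0 < (φ (2 * imagUnit L)⁻¹).im}.ncard) →
      ∃ a' : (↥(maximalRealSubfield L))ˣ,
        locF (↥(maximalRealSubfield L)) (imagUnitSq L) a' = locF (↥(maximalRealSubfield L)) (imagUnitSq L) a ∧
        IsAdmissibleElement L hμ.cmType.1 (algebraMap (↥(maximalRealSubfield L)) L a' * (2 * imagUnit L)⁻¹) :=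
  @Summit.HodgeConjecture.HodgeConjecture.Cruxes.H413.K2E2AdmRepresentative.admRepresentative  -- ★ RE-TIED BY IMPORT (statement bytes above FROZEN ∕ unchanged)

end Summit.HodgeConjecture.HodgeConjecture.Cruxes.H413.K2E2ThetaExhaustionByRigidity.AdmRep
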